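import Summits.Ventures.LatticeQCDFlow.Scoring.BlockFactorCLT
import Summits.Ventures.LatticeQCDFlow.Scoring.MeanSubtractionBias
import Summits.Ventures.LatticeQCDFlow.Scoring.LogRatioAgreementCLT
import Summits.Ventures.LatticeQCDFlow.Scoring.UStatisticVarianceEstimator

/-!
# Mean subtraction and the `1/(N−t)` normalisation are immaterial at the CLT scale: `√N (Γ̂_c(t) − Γ̂(t)) → 0` in probability

HONEST FRAMING: exact (Metropolis-corrected) sampling algorithms for lattice gauge theory;
figures of merit are autocorrelation/cost numbers at stated couplings and volumes; no
continuum-physics claim.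

Venture `LatticeQCDFlow` (cell pub-lqcd), sub-topic `Scoring`; FANOUT row 16 (`su2-base`), GEN-8.
NEW WORK of the cell over GEN-6's `MeanSubtractionBias` (`acovHatC`) and `LagProductCovariance`
(`acovHat`), GEN-7's `BlockFactorCLT`, row 4's `DeltaMethod` / `MultivariateDeltaMethod` /
`LogRatioAgreementCLT` (convergence-in-probability tools) and `UStatisticVarianceEstimator` (Markov ⇒
in probability), Mathlib's Slutsky lemmas; no definition; nothing cited as a fact.  Printed counterparts NAMED ONLY: Brockwell–Davis 1991 Prop. 7.3.4 (the
sample-mean correction is `o_p(N^{-1/2})`); Anderson 1971 §8.4.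

A file of the LAW-OF-THE-ERROR packet.  GEN-7's CLTs are stated for the KNOWN-MEAN, `1/N`-normalised
`Γ̂_N(t) = (1/N) Σ_{i<N} Y_i Y_{i+t}` of the centred process `Y = X − μ`; the scorers compute
`Γ̂_c(t) = (1/(N−t)) Σ_{i<N−t} (X_i − x̄_N)(X_{i+t} − x̄_N)` (GEN-6 `acovHatC`, whose `O(1/N)` BIAS is in
`MeanSubtractionBias`, the effect on the law listed there as NOT CLAIMED).  THIS FILE:
`√N (Γ̂_c(t) − Γ̂(t)) → 0` in probability whenever the lag products are bounded in `L¹` and the sample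
means obey a `√N`-law — in particular for every block-factor process — so (Slutsky) every `√N`-limit
law of `Γ̂_N(t)` is also that of the scorers' `Γ̂_c(t)` (docking with the joint CLT: a later file).

## Contents

* §1 tools: `tendstoInMeasure_zero_of_integral_abs_le` (Markov), `tendstoInMeasure_add_zero`,
  `tendstoInMeasure_neg_zero`, `tendstoInMeasure_mul_zero_of_tight`
  (`V_N ⇒ Z` and `U_N → 0` ⇒ `V_N U_N → 0`, Slutsky).
* §2 algebra: `acovHatC_add_const` (shift invariance), **`sqrt_mul_acovHatC_sub_acovHat`** — for
  `t < N`: `√N (Γ̂_c(t) − Γ̂(t)) = t/(√N (N−t)) · S − T/√N − (√N ȳ_N) · U_N`, `S = Σ_{i<N−t} Y_iY_{i+t}`,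
  `T = Σ_{N−t≤i<N} Y_iY_{i+t}`, `U_N = (Σ_{i<N−t} (Y_i + Y_{i+t}))/(N−t) − ȳ_N`.
* §3 **`tendstoInMeasure_sqrt_mul_acovHatC_sub_acovHat`** — THE ABSTRACT THEOREM; §4
  **`tendstoInMeasure_sqrt_mul_acovHatC_sub_acovHat_blockFactor`** — every hypothesis discharged for
  a block-factor process `X_i = F(ξ_i, …, ξ_{i+m})`, `ξ` i.i.d., `X_0 ∈ L²`, `μ = E X_0`, `Y = X − μ`.

NOT CLAIMED: the transfer of the joint CLT itself (needs `Scoring/LagProductCLT`; separate file);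
second-order (variance) effects; Markov-chain data.
-/

noncomputable section

open MeasureTheory ProbabilityTheory Filter Finset
open scoped Topology ENNReal
open Literature.Probability.MarkovChains (seqMean)

namespace Summit.Ventures.LatticeQCDFlow.Scoring

/-! ## §1 Tools -/

section Tools

variable {Ω : Type*} [MeasurableSpace Ω] {P : Measure Ω} [IsProbabilityMeasure P]
variable {Ω' : Type*} [MeasurableSpace Ω'] {P' : Measure Ω'} [IsProbabilityMeasure P']

/-- **Markov**: `E|R_N| ≤ b_N → 0` ⇒ `R_N → 0` in measure (row 4's
`CardConsistency.tendstoInMeasure_zero_of_integral_le` applied to `|R_N|`). -/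
theorem tendstoInMeasure_zero_of_integral_abs_le {R : ℕ → Ω → ℝ} {b : ℕ → ℝ}
    (hR : ∀ N, Integrable (R N) P) (hb : ∀ N, ∫ ω, |R N ω| ∂P ≤ b N)
    (hb0 : Tendsto b atTop (𝓝 0)) :
    TendstoInMeasure P R atTop fun _ => 0 := by
  have h := CardConsistency.tendstoInMeasure_zero_of_integral_le (P := P) (f := fun N ω => |R N ω|)
    (fun N ω => abs_nonneg _) hb0 (Eventually.of_forall fun N => ⟨(hR N).abs, hb N⟩)
  rw [tendstoInMeasure_iff_norm] at h ⊢
  simpa only [sub_zero, Real.norm_eq_abs, abs_abs] using h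

omit [IsProbabilityMeasure P] in
/-- The sum of two real sequences tending to `0` in measure tends to `0` in measure (pairing
`CardConsistency.tendstoInMeasure_prodMk` + continuous mapping). -/
theorem tendstoInMeasure_add_zero {R R' : ℕ → Ω → ℝ}
    (hR : TendstoInMeasure P R atTop fun _ => 0) (hR' : TendstoInMeasure P R' atTop fun _ => 0) :
    TendstoInMeasure P (fun N ω => R N ω + R' N ω) atTop fun _ => 0 := by
  simpa only [add_zero] using CardConsistency.tendstoInMeasure_comp_continuousAt_normed
    (CardConsistency.tendstoInMeasure_prodMk hR hR') (φ := fun q : ℝ × ℝ => q.1 + q.2)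
    (by fun_prop : Continuous fun q : ℝ × ℝ => q.1 + q.2).continuousAt

/-- **Tight times null is null** (Slutsky): `V_N ⇒ Z` (any limit law) and `U_N → 0` in measure ⇒
`V_N U_N → 0` in measure. -/
theorem tendstoInMeasure_mul_zero_of_tight {V U : ℕ → Ω → ℝ} {Z : Ω' → ℝ}
    (hV : TendstoInDistribution V atTop Z (fun _ => P) P')
    (hU : TendstoInMeasure P U atTop fun _ => 0) (hUm : ∀ N, AEMeasurable (U N) P) :
    TendstoInMeasure P (fun N ω => V N ω * U N ω) atTop fun _ => 0 := by
  have h := hV.continuous_comp_prodMk_of_tendstoInMeasure_const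
    (g := fun z : ℝ × ℝ => z.1 * z.2) (by fun_prop) hU hUm
  have h0 : TendstoInDistribution (fun N ω => V N ω * U N ω) atTop (fun _ : Ω' => (0 : ℝ))
      (fun _ => P) P' :=
    h.congr (fun N => Eventually.of_forall fun ω => rfl) (Eventually.of_forall fun ω' => by simp)
  exact CardConsistency.tendstoInMeasure_of_tendstoInDistribution_const h0

omit [IsProbabilityMeasure P] in
/-- Negation preserves convergence to `0` in measure. -/
theorem tendstoInMeasure_neg_zero {R : ℕ → Ω → ℝ} (hR : TendstoInMeasure P R atTop fun _ => 0) :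
    TendstoInMeasure P (fun N ω => -R N ω) atTop fun _ => 0 :=
  fun ε hε => by simpa only [edist_neg, neg_zero] using hR ε hε

end Tools

/-! ## §2 Algebra of the centred estimator -/

section Algebra

variable {Ω : Type*}

/-- **Shift invariance**: the centred estimator of `Y + μ` is that of `Y` (`N ≠ 0`). -/
theorem acovHatC_add_const (Y : ℕ → Ω → ℝ) (μ : ℝ) {N : ℕ} (hN : N ≠ 0) (t : ℕ) :
    acovHatC (fun i ω => Y i ω + μ) N t = acovHatC Y N t := by
  funext ω
  have hmean : seqMean N (fun i ω => Y i ω + μ) ω = seqMean N Y ω + μ := by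
    simp only [seqMean, sum_add_distrib, sum_const, card_range, nsmul_eq_mul]
    have hN' : (N : ℝ) ≠ 0 := Nat.cast_ne_zero.2 hN
    field_simp
  simp only [acovHatC, hmean]
  congr 1
  refine sum_congr rfl fun i _ => ?_
  ring

/-- **THE EXACT DECOMPOSITION** (`t < N`) of `√N (Γ̂_c(t) − Γ̂(t))` into the three terms of §3. -/
theorem sqrt_mul_acovHatC_sub_acovHat (Y : ℕ → Ω → ℝ) {N t : ℕ} (ht : t < N) (ω : Ω) :
    Real.sqrt N * (acovHatC Y N t ω - acovHat Y N t ω)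
      = (t : ℝ) / (Real.sqrt N * ((N - t : ℕ) : ℝ)) * ∑ i ∈ range (N - t), Y i ω * Y (i + t) ω
        - (∑ i ∈ Ico (N - t) N, Y i ω * Y (i + t) ω) / Real.sqrt N
        - (Real.sqrt N * seqMean N Y ω)
          * ((∑ i ∈ range (N - t), (Y i ω + Y (i + t) ω)) / ((N - t : ℕ) : ℝ) - seqMean N Y ω) := by
  have hN : 0 < N := lt_of_le_of_lt (Nat.zero_le t) ht
  have hNt : (0 : ℝ) < ((N - t : ℕ) : ℝ) := by exact_mod_cast Nat.sub_pos_of_lt ht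
  have hNr : (0 : ℝ) < N := Nat.cast_pos.2 hN
  have hs : Real.sqrt N ≠ 0 := Real.sqrt_ne_zero'.2 hNr
  set yb := seqMean N Y ω with hyb
  -- the full lag-product sum splits into the kept part and the `t` dropped products
  have hsplit : ∑ i ∈ range N, Y i ω * Y (i + t) ω
      = ∑ i ∈ range (N - t), Y i ω * Y (i + t) ω + ∑ i ∈ Ico (N - t) N, Y i ω * Y (i + t) ω :=
    (sum_range_add_sum_Ico _ (Nat.sub_le N t)).symm
  -- expand the centred products
  have hexp : ∑ i ∈ range (N - t), (Y i ω - yb) * (Y (i + t) ω - yb)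
      = ∑ i ∈ range (N - t), Y i ω * Y (i + t) ω
        - yb * ∑ i ∈ range (N - t), (Y i ω + Y (i + t) ω) + ((N - t : ℕ) : ℝ) * yb ^ 2 := by
    rw [mul_sum, ← sum_sub_distrib]
    have : ∀ i ∈ range (N - t), (Y i ω - yb) * (Y (i + t) ω - yb)
        = (Y i ω * Y (i + t) ω - yb * (Y i ω + Y (i + t) ω)) + yb ^ 2 := fun i _ => by ring
    rw [sum_congr rfl this, sum_add_distrib, sum_const, card_range, nsmul_eq_mul]
  simp only [acovHatC, acovHat_apply, ← hyb, hexp, hsplit]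
  set S := ∑ i ∈ range (N - t), Y i ω * Y (i + t) ω
  set T := ∑ i ∈ Ico (N - t) N, Y i ω * Y (i + t) ω
  set A := ∑ i ∈ range (N - t), (Y i ω + Y (i + t) ω)
  set s := Real.sqrt (N : ℝ) with hs_def
  have hcast : ((N - t : ℕ) : ℝ) = s * s - t := by
    rw [hs_def, Real.mul_self_sqrt hNr.le]; push_cast [Nat.cast_sub ht.le]; ring
  have hNs : (N : ℝ) = s * s := by rw [hs_def, Real.mul_self_sqrt hNr.le]
  have hst : s ^ 2 - t ≠ 0 := by rw [sq, ← hcast]; exact hNt.ne'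
  rw [hcast, hNs]
  field_simp
  ring

end Algebra

/-! ## §3 The abstract theorem -/

section Abstract

variable {Ω : Type*} [MeasurableSpace Ω] {P : Measure Ω} [IsProbabilityMeasure P]
variable {Ω' : Type*} [MeasurableSpace Ω'] {P' : Measure Ω'} [IsProbabilityMeasure P']

/-- **MEAN SUBTRACTION AND `1/(N−t)` ARE `o_p(N^{-1/2})`.**  `X = Y + μ`, `Y` measurable with
`E|Y_iY_{i+t}| ≤ M` for all `i`, `√N ȳ_N ⇒ Z` (ANY limit), shifted sample means `(1/N) Σ_{i<N} Y_{i+t} → 0`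
in measure.  Then `√N (Γ̂_c(t)[X] − Γ̂(t)[Y]) → 0` in measure. -/
theorem tendstoInMeasure_sqrt_mul_acovHatC_sub_acovHat {X Y : ℕ → Ω → ℝ} {μ : ℝ} {t : ℕ}
    (hXY : ∀ i ω, X i ω = Y i ω + μ) (hYm : ∀ i, Measurable (Y i)) {M : ℝ}
    (hint : ∀ i, Integrable (fun ω => Y i ω * Y (i + t) ω) P)
    (hM : ∀ i, ∫ ω, |Y i ω * Y (i + t) ω| ∂P ≤ M) {Z : Ω' → ℝ}
    (hmean : TendstoInDistribution (fun (N : ℕ) ω => Real.sqrt N * seqMean N Y ω) atTop Z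
      (fun _ => P) P')
    (hshift : TendstoInMeasure P (fun (N : ℕ) ω => (∑ i ∈ range N, Y (i + t) ω) / N) atTop
      fun _ => 0) :
    TendstoInMeasure P (fun (N : ℕ) ω => Real.sqrt N * (acovHatC X N t ω - acovHat Y N t ω))
      atTop fun _ => 0 := by
  have hM0 : 0 ≤ M := (integral_nonneg fun ω => abs_nonneg _).trans (hM 0)
  have hX : X = fun i ω => Y i ω + μ := funext fun i => funext fun ω => hXY i ω
  have hb0 : Tendsto (fun N : ℕ => (t : ℝ) * M / Real.sqrt N) atTop (𝓝 0) :=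
    tendsto_const_nhds.div_atTop (Real.tendsto_sqrt_atTop.comp tendsto_natCast_atTop_atTop)
  -- the three terms of the decomposition
  set R1 : ℕ → Ω → ℝ := fun N ω => (t : ℝ) / (Real.sqrt N * ((N - t : ℕ) : ℝ))
    * ∑ i ∈ range (N - t), Y i ω * Y (i + t) ω with hR1_def
  set R2 : ℕ → Ω → ℝ := fun N ω => (∑ i ∈ Ico (N - t) N, Y i ω * Y (i + t) ω) / Real.sqrt N
    with hR2_def
  set V : ℕ → Ω → ℝ := fun N ω => Real.sqrt N * seqMean N Y ω with hV_def
  set U : ℕ → Ω → ℝ := fun N ω =>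
    (∑ i ∈ range (N - t), (Y i ω + Y (i + t) ω)) / ((N - t : ℕ) : ℝ) - seqMean N Y ω with hU_def
  have hsum_int : ∀ (s : Finset ℕ), Integrable (fun ω => ∑ i ∈ s, Y i ω * Y (i + t) ω) P :=
    fun s => integrable_finsetSum _ fun i _ => hint i
  have hsum_abs : ∀ (s : Finset ℕ), ∫ ω, |∑ i ∈ s, Y i ω * Y (i + t) ω| ∂P ≤ s.card * M := by
    intro s
    refine (integral_mono (hsum_int s).abs (integrable_finsetSum _ fun i _ => (hint i).abs)
      fun ω => abs_sum_le_sum_abs _ _).trans ?_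
    rw [integral_finsetSum _ fun i _ => (hint i).abs]
    exact (sum_le_sum fun i _ => hM i).trans (by rw [sum_const, nsmul_eq_mul])
  have hR1 : TendstoInMeasure P R1 atTop fun _ => 0 := by
    refine tendstoInMeasure_zero_of_integral_abs_le (fun N => (hsum_int _).const_mul _)
      (fun N => ?_) hb0
    · simp only [hR1_def]
      rw [integral_congr_ae (ae_of_all _ fun ω => abs_mul _ _), integral_const_mul]
      rcases Nat.eq_zero_or_pos N with hN | hN
      · subst hN; simp
      · rcases Nat.lt_or_ge t N with htN | htN
        · have hNt : (0 : ℝ) < ((N - t : ℕ) : ℝ) := by exact_mod_cast Nat.sub_pos_of_lt htN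
          have hsN : 0 < Real.sqrt N := Real.sqrt_pos.2 (Nat.cast_pos.2 hN)
          rw [abs_of_nonneg (by positivity)]
          calc (t : ℝ) / (Real.sqrt N * ((N - t : ℕ) : ℝ)) * ∫ ω, |∑ i ∈ range (N - t), Y i ω * Y (i + t) ω| ∂P
              ≤ (t : ℝ) / (Real.sqrt N * ((N - t : ℕ) : ℝ)) * ((range (N - t)).card * M) :=
                mul_le_mul_of_nonneg_left (hsum_abs _) (by positivity)
            _ = t * M / Real.sqrt N := by
                rw [card_range]; field_simp
        · have h0 : N - t = 0 := Nat.sub_eq_zero_of_le htN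
          simp only [h0, range_zero, sum_empty, abs_zero, integral_zero, mul_zero]
          positivity
  -- R2 → 0 in measure: E|R2_N| ≤ t M/√N
  have hR2 : TendstoInMeasure P R2 atTop fun _ => 0 := by
    refine tendstoInMeasure_zero_of_integral_abs_le (fun N => (hsum_int _).div_const _)
      (fun N => ?_) hb0
    · simp only [hR2_def]
      rcases Nat.eq_zero_or_pos N with hN | hN
      · subst hN; simp
      · have hsN : 0 < Real.sqrt N := Real.sqrt_pos.2 (Nat.cast_pos.2 hN)
        rw [integral_congr_ae (ae_of_all _ fun ω => abs_div _ _)]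
        simp only [abs_of_pos hsN]
        rw [integral_div]
        refine div_le_div_of_nonneg_right ((hsum_abs _).trans ?_) hsN.le
        rw [Nat.card_Ico]
        exact mul_le_mul_of_nonneg_right (by exact_mod_cast tsub_tsub_le) hM0
  -- U → 0 in measure: three sample means
  have hmean0 : TendstoInMeasure P (fun N => seqMean N Y) atTop fun _ => 0 :=
    CardConsistency.tendstoInMeasure_of_tendstoInDistribution_scaled (θ := 0)
      (X := fun N => seqMean N Y) (a := fun n : ℕ => Real.sqrt (n : ℝ))
      (Real.tendsto_sqrt_atTop.comp tendsto_natCast_atTop_atTop)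
      (Z := Z) (by simpa only [sub_zero] using hmean)
  have hU : TendstoInMeasure P U atTop fun _ => 0 := by
    have hA : TendstoInMeasure P (fun (N : ℕ) ω => (∑ i ∈ range (N - t), Y (i + t) ω) / ((N - t : ℕ) : ℝ))
        atTop fun _ => 0 := fun ε hε => (hshift ε hε).comp (tendsto_sub_atTop_nat t)
    have hB : TendstoInMeasure P (fun (N : ℕ) ω => seqMean (N - t) Y ω) atTop fun _ => 0 :=
      fun ε hε => (hmean0 ε hε).comp (tendsto_sub_atTop_nat t)
    have hC : TendstoInMeasure P (fun (N : ℕ) ω => -seqMean N Y ω) atTop fun _ => 0 :=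
      tendstoInMeasure_neg_zero hmean0
    have h := tendstoInMeasure_add_zero (tendstoInMeasure_add_zero hB hA) hC
    refine h.congr (fun N => Eventually.of_forall fun ω => ?_) EventuallyEq.rfl
    show seqMean (N - t) Y ω + (∑ i ∈ range (N - t), Y (i + t) ω) / ((N - t : ℕ) : ℝ)
        + -seqMean N Y ω = U N ω
    simp only [hU_def, seqMean, sum_add_distrib, add_div]
    ring
  have hUm : ∀ N, AEMeasurable (U N) P := by
    intro N
    simp only [hU_def, seqMean]
    exact (((Finset.measurable_sum _ fun i _ => (hYm i).add (hYm _)).div_const _).sub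
      ((Finset.measurable_sum _ fun i _ => hYm i).div_const _)).aemeasurable
  have hVU : TendstoInMeasure P (fun N ω => V N ω * U N ω) atTop fun _ => 0 :=
    tendstoInMeasure_mul_zero_of_tight hmean hU hUm
  -- assemble: eventually (N > t) the statistic IS R1 − R2 − V U
  have hall := tendstoInMeasure_add_zero (tendstoInMeasure_add_zero hR1 (tendstoInMeasure_neg_zero hR2))
    (tendstoInMeasure_neg_zero hVU)
  refine hall.congr' ?_ EventuallyEq.rfl
  filter_upwards [eventually_gt_atTop t] with N hN
  refine Eventually.of_forall fun ω => ?_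
  have hN0 : N ≠ 0 := by omega
  show R1 N ω + -R2 N ω + -(V N ω * U N ω)
    = Real.sqrt N * (acovHatC X N t ω - acovHat Y N t ω)
  rw [hX, acovHatC_add_const Y μ hN0 t, sqrt_mul_acovHatC_sub_acovHat Y hN ω]
  simp only [hR1_def, hR2_def, hV_def, hU_def]
  ring

end Abstract

/-! ## §4 Block-factor processes: every hypothesis discharged -/

section BlockFactor

variable {Ω : Type*} [MeasurableSpace Ω] {P : Measure Ω} [IsProbabilityMeasure P]
variable {S : Type*} [MeasurableSpace S] {ξ : ℕ → Ω → S} {m : ℕ} {F : (Fin (m + 1) → S) → ℝ}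

omit [MeasurableSpace Ω] [MeasurableSpace S] in
/-- The block factors of the shifted sequence `j ↦ ξ_{j+t}` are the shifted block factors. -/
theorem blockFactor_shift (F : (Fin (m + 1) → S) → ℝ) (ξ : ℕ → Ω → S) (t i : ℕ) (ω : Ω) :
    blockFactor F (fun j => ξ (j + t)) i ω = blockFactor F ξ (i + t) ω := by
  show F (fun l : Fin (m + 1) => ξ (i + l + t) ω) = F (fun l : Fin (m + 1) => ξ (i + t + l) ω)
  simp only [Nat.add_right_comm]

/-- **Shifted sample means of a centred block factor `→ 0` in measure**: `Y = X − E X_0`,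
`(1/N) Σ_{i<N} Y_{i+t} → 0` (the `√N`-law of the shifted i.i.d. sequence pins the centring). -/
theorem tendstoInMeasure_shiftedMean_blockFactor (hξ : ∀ i, Measurable (ξ i)) (hind : iIndepFun ξ P)
    (hid : ∀ i, IdentDistrib (ξ i) (ξ 0) P P) (hF : Measurable F)
    (h2 : MemLp (blockFactor F ξ 0) 2 P) (t : ℕ) :
    TendstoInMeasure P (fun (N : ℕ) ω => (∑ i ∈ range N,
        (blockFactor F ξ (i + t) ω - P[blockFactor F ξ 0])) / N) atTop fun _ => 0 := by
  -- the shifted sequence is i.i.d. with the same marginal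
  set ξ' : ℕ → Ω → S := fun j => ξ (j + t) with hξ'
  have hξ'm : ∀ i, Measurable (ξ' i) := fun i => hξ _
  have hind' : iIndepFun ξ' P := hind.precomp (add_left_injective t)
  have hid' : ∀ i, IdentDistrib (ξ' i) (ξ' 0) P P := fun i =>
    (hid (i + t)).trans (by simpa only [hξ', zero_add] using (hid t).symm)
  -- the centred factor
  set Fc : (Fin (m + 1) → S) → ℝ := fun w => F w - P[blockFactor F ξ 0] with hFc
  have hFc_m : Measurable Fc := hF.sub_const _
  have hY' : ∀ i ω, blockFactor Fc ξ' i ω = blockFactor F ξ (i + t) ω - P[blockFactor F ξ 0] := by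
    intro i ω
    rw [← blockFactor_shift F ξ t i ω]
    rfl
  have h2' : MemLp (blockFactor Fc ξ' 0) 2 P := by
    have e : blockFactor Fc ξ' 0 = fun ω => blockFactor F ξ (0 + t) ω - P[blockFactor F ξ 0] :=
      funext fun ω => hY' 0 ω
    rw [e]
    exact (memLp_blockFactor hind hid hF h2 _).sub (memLp_const _)
  have hmean0 : P[blockFactor Fc ξ' 0] = 0 := by
    have e : blockFactor Fc ξ' 0 = fun ω => blockFactor F ξ (0 + t) ω - P[blockFactor F ξ 0] :=
      funext fun ω => hY' 0 ω
    rw [e, integral_sub ((memLp_blockFactor hind hid hF h2 _).integrable one_le_two)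
      (integrable_const _), integral_blockFactor hind hid hF, integral_const, smul_eq_mul]
    simp
  have hclt := tendstoInDistribution_blockFactor_mean hξ'm hind' hid' hFc_m h2' (Y := id)
    (P' := gaussianReal 0 (lrVar (fun s => cov[blockFactor Fc ξ' 0, blockFactor Fc ξ' s; P]) m).toNNReal)
    HasLaw.id
  rw [hmean0] at hclt
  refine (CardConsistency.tendstoInMeasure_of_tendstoInDistribution_scaled (θ := 0)
    (X := fun (N : ℕ) ω => (∑ i ∈ range N, blockFactor Fc ξ' i ω) / N)
    (a := fun n : ℕ => Real.sqrt (n : ℝ)) (Real.tendsto_sqrt_atTop.comp tendsto_natCast_atTop_atTop)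
    (Z := id) hclt).congr (fun N => Eventually.of_forall fun ω => ?_) EventuallyEq.rfl
  simp only [hY']

/-- **MEAN SUBTRACTION AND `1/(N−t)` ARE `o_p(N^{-1/2})` FOR EVERY BLOCK-FACTOR PROCESS.**  `ξ` i.i.d.,
`X_i = F(ξ_i, …, ξ_{i+m})` square integrable, `μ = E X_0`, `Y = X − μ`.  Then at every lag `t`:
`√N (Γ̂_c(t)[X] − Γ̂(t)[Y]) → 0` in measure — the scorers' centred, `1/(N−t)`-normalised estimator and
the known-mean `1/N` estimator of the packet have the same `√N`-limit laws. -/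
theorem tendstoInMeasure_sqrt_mul_acovHatC_sub_acovHat_blockFactor (hξ : ∀ i, Measurable (ξ i))
    (hind : iIndepFun ξ P) (hid : ∀ i, IdentDistrib (ξ i) (ξ 0) P P) (hF : Measurable F)
    (h2 : MemLp (blockFactor F ξ 0) 2 P) (t : ℕ) :
    TendstoInMeasure P (fun (N : ℕ) ω => Real.sqrt N * (acovHatC (blockFactor F ξ) N t ω
        - acovHat (fun i ω => blockFactor F ξ i ω - P[blockFactor F ξ 0]) N t ω)) atTop
      fun _ => 0 := by
  set μ : ℝ := P[blockFactor F ξ 0] with hμ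
  set Fc : (Fin (m + 1) → S) → ℝ := fun w => F w - μ with hFc
  have hFc_m : Measurable Fc := hF.sub_const _
  have hY : ∀ i ω, blockFactor Fc ξ i ω = blockFactor F ξ i ω - μ := fun i ω => rfl
  have hYfun : (fun i ω => blockFactor F ξ i ω - μ) = blockFactor Fc ξ :=
    funext fun i => funext fun ω => (hY i ω).symm
  rw [hYfun]
  have h2c : MemLp (blockFactor Fc ξ 0) 2 P := h2.sub (memLp_const _)
  have h2ci : ∀ i, MemLp (blockFactor Fc ξ i) 2 P := memLp_blockFactor hind hid hFc_m h2c
  -- uniform `L¹` bound on the lag products by stationarity of pairs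
  have hpair : ∀ i, IdentDistrib (fun ω => blockFactor Fc ξ i ω * blockFactor Fc ξ (i + t) ω)
      (fun ω => blockFactor Fc ξ 0 ω * blockFactor Fc ξ t ω) P P := fun i =>
    (identDistrib_blockFactor_pair hind hid hFc_m i t).comp (u := fun q : ℝ × ℝ => q.1 * q.2)
      (by fun_prop)
  have hint : ∀ i, Integrable (fun ω => blockFactor Fc ξ i ω * blockFactor Fc ξ (i + t) ω) P :=
    fun i => (h2ci i).integrable_mul (h2ci (i + t))
  have hM : ∀ i, ∫ ω, |blockFactor Fc ξ i ω * blockFactor Fc ξ (i + t) ω| ∂P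
      ≤ ∫ ω, |blockFactor Fc ξ 0 ω * blockFactor Fc ξ t ω| ∂P := fun i =>
    (((hpair i).comp measurable_abs).integral_eq).le
  -- the `√N`-law of the sample mean (m-dependent CLT), with `E Y_0 = 0`
  have hmean0 : P[blockFactor Fc ξ 0] = 0 := by
    simp only [hY]
    rw [integral_sub (h2.integrable one_le_two) (integrable_const _), integral_const, smul_eq_mul]
    simp [hμ]
  have hclt := tendstoInDistribution_blockFactor_mean hξ hind hid hFc_m h2c (Y := id)
    (P' := gaussianReal 0 (lrVar (fun s => cov[blockFactor Fc ξ 0, blockFactor Fc ξ s; P]) m).toNNReal)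
    HasLaw.id
  rw [hmean0] at hclt
  have hmean : TendstoInDistribution (fun (N : ℕ) ω => Real.sqrt N * seqMean N (blockFactor Fc ξ) ω)
      atTop id (fun _ => P) (gaussianReal 0
        (lrVar (fun s => cov[blockFactor Fc ξ 0, blockFactor Fc ξ s; P]) m).toNNReal) :=
    hclt.congr (fun N => Eventually.of_forall fun ω => by simp [seqMean]) EventuallyEq.rfl
  -- shifted sample means `→ 0`
  have hshift : TendstoInMeasure P (fun (N : ℕ) ω => (∑ i ∈ range N, blockFactor Fc ξ (i + t) ω) / N)
      atTop fun _ => 0 := by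
    have h := tendstoInMeasure_shiftedMean_blockFactor hξ hind hid hF h2 t
    simpa only [hY] using h
  exact tendstoInMeasure_sqrt_mul_acovHatC_sub_acovHat (μ := μ) (fun i ω => by rw [hY]; ring)
    (fun i => measurable_blockFactor hξ hFc_m i) hint hM hmean hshift

end BlockFactor

end Summit.Ventures.LatticeQCDFlow.Scoring

end
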